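import Literature.MathematicalPhysics.QuantumFieldTheory.Balaban1983to89.B9Thm31FlatPoincareCoerciveZd
import Literature.MathematicalPhysics.QuantumFieldTheory.Balaban1983to89.B9Eq324NearFlatFormComparisonZdTowerPairs
import Literature.MathematicalPhysics.QuantumFieldTheory.Balaban1983to89.B9Eq326LocalLettersBumpBoundsZd
import Literature.MathematicalPhysics.QuantumFieldTheory.Balaban1983to89.B8Eq143PlaqExpansion

/-!
# `Balaban1983to89.B9Thm31NearFlatCoerciveCubeZd` — [Balaban1985BackgroundPropagators] Thm 3.1 p. 397 ∕ Thm 3.11 p. 416 with [Balaban1984PropagatorsII] (2.22) p. 226 AT NEAR-FLAT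
# BACKGROUNDS ON THE `ℤᵈ × 𝔸` CARRIER: THE MEMBER-UNIFORM COERCIVITY OF `Ω₀Δ′_a(U₀)Ω₀` — `(a₀∕2 − dθ² − κ)·⟨f, f⟩_τ ≤ ⟨f, Ω₀Δ′_a(U₀)Ω₀ f⟩_τ`, `a₀ = min{8, a}` — under the full
# block geometry with cover (and, with NO geometric hypothesis, at every cube member of [Balaban1985RegularSpaces] (1.131)), for every unitary background whose bond conjugations are
# `θη`-close and whose averaged tower transporters `Ū₀ⁱ(Γ_{blockMap L w, w})` are `ε_i`-close to the identity in the `τ`-size: the flat block-Poincaré constant of `B9Thm31FlatPoincareCoerciveZd` transferred by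
# `B9Eq324NearFlatFormComparisonZd`

statement-level skeleton of published theorems with citation tags; proofs where landed; nothing here is a claim about the
Yang–Mills mass gap

`[Balaban1985BackgroundPropagators]` ("B9", CMP **99** (1985) 389–434) Thm 3.1 p. 397, Thm 3.11 p. 416 («This is obvious for the first three operators … doing the gauge transformation
we get the configuration U = e^{iηA} with A small, and by (3.86) … G_□(1) is positive, hence by the same reasoning as above we prove positivity of G_□»), (3.23)–(3.24) p. 394;
`[Balaban1984PropagatorsII]` (2.22) p. 226, (2.26)–(2.27) p. 235; `[Balaban1985RegularSpaces]` (1.131) p. 99.  PDF held: `paper:balaban1985-cmp99-background-propagators` p. 416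
(re-read 2026-08-28).

CITATION HEADER (lean-in-tree rule).  Cell `pub-ymgap` (YM Track A, D-0062 ∕ D-0149), node N06 = [B9], width seat `pub-ymgap-dag-n06-w4` (g5), CLAIM-7 ∕ INTENT-7 — the knot of
CLAIM-5 (flat, `formE_deltaPrimeADom_one_coercive_uniform ∕ _cubeMember`) and CLAIM-6∕6b (transfer, `coercive_of_flat_coercive_near_flat'` — the tower-pair edition of
`B9Eq324NearFlatFormComparisonZdTowerPairs`), plus the operator-norm reading; inputs BY NAME:
those two files, g5 `B9Eq319QQStarDiagonalZd` (`FullBlockGeometry`, `fullBlockGeometry_cubeMember`), `B9Thm311PosDefOpenZd.cubeMember_Ω0_finite`, `B8Eq191FlatLettersCubeMember.cubeLamS_finite`,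
dag-n06-b's `B9Eq326LocalLettersBumpBoundsZd.exists_fnorm_cmp` (the constants `C_u, C_l` are taken as hypotheses in its shape), dag-n05's `B8Eq143PlaqExpansion.norm_conjR_sub_self_le`,
`B7Prop2Explicit.unitaryUnits_le_U1`.

WHAT IS PROVED (kernel, 0 sorry; theorems only).
* ★★★ `coercive_near_flat_of_fullBlockGeometry` — `FullBlockGeometry` + cover + `η·Lʲ ≤ 1` + weights `a₀(Lʲ)^d ≤ a_jη²(Lʲ)²` (`a₀ ≤ 8`) + the displayed near-flat hypotheses ⟹
  `(a₀∕2 − dθ² − κ)·⟨f, f⟩_τ ≤ ⟨f, Ω₀Δ′_a(U₀)Ω₀ f⟩_τ`.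
* ★★★ `coercive_near_flat_cubeMember` — the same at every cube member (`Λ_j = cubeLamS … m j`, `s = □₀`, `L ≤ ρ`, `m ≤ k`), no geometric hypothesis.
* §2 `fnorm_conjR_sub_le_of_cmp` (`|R(u)b − b|_τ ≤ 2C_uC_l‖u − 1‖|b|_τ`), ★★★ `coercive_near_flat_cubeMember_of_norm` (the same with OPERATOR-NORM closeness `‖U₀(b) − 1‖ ≤ θ′η`,
  `‖Ū₀ⁱ(Γ) − 1‖ ≤ ε′_i` and the norm-comparison constants of dag-n06-b's `exists_fnorm_cmp`: constant `a₀∕2 − (2C_uC_l)²(dθ′² + κ′)`).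
* §3 ★★ `formE_GpZd_self_le_near_flat_cubeMember` (`‖G′(U₀)f‖²_τ ≤ γ⁻²‖f‖²_τ`, `γ = a₀∕2 − dθ² − κ > 0` member-uniform — Thm 3.1's `L²` content for `G′`).

HONEST SCOPE.  Constants explicit and member-uniform (`a₀∕2 − dθ² − κ`); the near-flat hypotheses are DISPLAYED in the `τ`-size at scale `η` — their derivation on the class
(3.35) (block axial gauge, [Balaban1985Averaging] (122)–(126), gauge covariance of the form) is NOT here; `L²_τ` currency, no decay; count-neutral helper (`--supports` the K1 item of
record); N05 ∕ N06 NOT discharged; K1 NOT closed; one finite `𝕋⁴` programme at fixed `ε`, Bałaban as printed; R4 closes only the conditional finite-`𝕋⁴` rung `BalabanLadder.UV` —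
nothing continuum ∕ ℝ⁴ ∕ OS ∕ mass gap ∕ Clay.  Unit `pub-ymgap-dag-n06-w4` (g5), 2026-08-28.
-/

noncomputable section

namespace Literature.MathematicalPhysics.QuantumFieldTheory.Balaban1983to89.B9Thm31NearFlatCoerciveCubeZd

open B7Prop1Explicit
open B7Eq78Linearization (conjR)
open B7Prop2Explicit (unitaryUnits)
open B8Eq119TwistedAxial (bgT)
open Literature.MathematicalPhysics.QuantumLattice (blockMap)
open B8Eq131CubesAdmissible (cubeFam)
open B8CubeMemberZd (cubeLamS)
open B8LeafModelZd (ZdIdx)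
open B8Eq191FlatLettersCubeMember (cubeLamS_finite)
open B9Eq321LandauProjectionZd (suppSub formE)
open B9Eq324DeltaPrimeAZd (deltaPrimeADom GpZd)
open B9Thm311InverseL2BoundsZd (formE_GpZd_self_le_of_coercive)
open B9Eq325QprimeSingleSiteZd (blockMapIter)
open B9Eq342CombesThomasFormZd (fnorm)
open B9Thm311PosDefOpenZd (cubeMember_Ω0_finite)
open B9Eq319QQStarDiagonalZd (FullBlockGeometry fullBlockGeometry_cubeMember)
open B9Thm31FlatPoincareCoerciveZd (formE_deltaPrimeADom_one_coercive_uniform formE_deltaPrimeADom_one_coercive_cubeMember)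
open B9Eq324NearFlatFormComparisonZdTowerPairs (coercive_of_flat_coercive_near_flat')

-- `Site` alone could resolve to the torus sites of `Setup.lean`; re-export the `ℤ^d` sites of `B7Prop1Explicit`.
export B7Prop1Explicit (Site)

variable {d : ℕ} {𝔸 : Type*} [CStarAlgebra 𝔸] [FiniteDimensional ℝ 𝔸]
variable (τ : 𝔸 →ₗ[ℂ] ℂ) (hτp : ∀ a : 𝔸, a ≠ 0 → 0 < (τ (star a * a)).re)
  (hτt : ∀ a b : 𝔸, τ (a * b) = τ (b * a)) (hτs : ∀ a : 𝔸, τ (star a) = starRingEnd ℂ (τ a))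
variable {L : ℕ} [NeZero L] {η : ℝ} {U₀ : Site d → Fin d → 𝔸ˣ} {θ : ℝ}

include hτt hτs in
/-- ★★★ **MEMBER-UNIFORM COERCIVITY OF `Ω₀Δ′_a(U₀)Ω₀` AT A NEAR-FLAT BACKGROUND, FULL BLOCK GEOMETRY WITH COVER**: for a unitary `U₀` whose bond conjugations are `θη`-close to the
identity in the `τ`-size, unitary averaged transporters below `m` that are `ε_i`-close, weights with `a₀(Lʲ)^d ≤ a_jη²(Lʲ)²` (`a₀ ≤ 8`) and `a_j(Lᵈ)^{−j}(Σ_{i<j}ε_i)² ≤ κ`, `η·Lʲ ≤ 1`: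
`(a₀∕2 − dθ² − κ)·⟨f, f⟩_τ ≤ ⟨f, Ω₀Δ′_a(U₀)Ω₀ f⟩_τ` for every `f ∈ L²(Ω₀, ·)`.
[cite: Balaban1985BackgroundPropagators, Thm 3.1 p.397, Thm 3.11 p.416, (3.23)–(3.24) p.394; Balaban1984PropagatorsII, (2.22) p.226, (2.26)–(2.27) p.235] -/
theorem coercive_near_flat_of_fullBlockGeometry (hη : 0 < η) (hU : ∀ (x : Site d) (κ' : Fin d), U₀ x κ' ∈ unitaryUnits 𝔸)
    (hR : ∀ (x : Site d) (μ : Fin d) (b : 𝔸), fnorm τ (conjR (U₀ x μ) b - b) ≤ θ * η * fnorm τ b)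
    (m : ℕ) {a : ℕ → ℝ} (ha : ∀ j, 0 ≤ a j) (Λ : ℕ → Finset (Site d)) {s : Finset (Site d)}
    (hG : FullBlockGeometry L m Λ s) (hcov : ∀ x ∈ s, ∃ j ∈ Finset.range (m + 1), blockMapIter L j x ∈ Λ j)
    (hηL : ∀ j ∈ Finset.range (m + 1), η * (L : ℝ) ^ j ≤ 1)
    {a₀ : ℝ} (ha₀8 : a₀ ≤ 8) (ha₀ : ∀ j ∈ Finset.range (m + 1), a₀ * ((L : ℝ) ^ j) ^ d ≤ a j * η ^ 2 * ((L : ℝ) ^ j) ^ 2)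
    {ε : ℕ → ℝ} (hε : ∀ i, 0 ≤ ε i) (hT : ∀ i, i < m → ∀ z y : Site d, bgT L U₀ i z y ∈ unitaryUnits 𝔸)
    (hTε : ∀ i, i < m → ∀ (w : Site d) (b : 𝔸), fnorm τ (conjR (bgT L U₀ i (blockMap L w) w) b - b) ≤ ε i * fnorm τ b)
    {κ : ℝ} (hκ0 : 0 ≤ κ) (hκ : ∀ j ∈ Finset.range (m + 1), a j * ((((L : ℝ) ^ d) ^ j)⁻¹ * (∑ i ∈ Finset.range j, ε i) ^ 2) ≤ κ)
    (f : suppSub (𝔸 := 𝔸) s) :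
    (a₀ / 2 - d * θ ^ 2 - κ) * formE τ s f f ≤ formE τ s f (deltaPrimeADom L U₀ η τ hτp m a Λ s f) :=
  coercive_of_flat_coercive_near_flat' τ hτp hτt hτs hη hU hR m ha Λ (fun j hj y hy => (hG j hj y hy).2) hε hT hTε hκ0 hκ
    (fun g => formE_deltaPrimeADom_one_coercive_uniform τ hτp hτt hτs hη m ha Λ hG hcov hηL ha₀8 ha₀ g) f

include hτt hτs in
/-- ★★★ **MEMBER-UNIFORM COERCIVITY OF `□₀Δ′_a(U₀)□₀` AT A NEAR-FLAT BACKGROUND, AT EVERY CUBE MEMBER OF (1.131)** (`Λ_j = cubeLamS … m j`, `s = □₀ = i.Ω 0`, `L ≤ ρ`, `m ≤ i.k`; `η·Lʲ ≤ 1`,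
weights `a₀(Lʲ)^d ≤ a_jη²(Lʲ)²`, `a₀ ≤ 8`): for a unitary `U₀` with `θη`-close bond conjugations and `ε_i`-close unitary averaged transporters below `m` (`a_j(Lᵈ)^{−j}(Σ_{i<j}ε_i)² ≤ κ`),
`(a₀∕2 − dθ² − κ)·⟨f, f⟩_τ ≤ ⟨f, □₀Δ′_a(U₀)□₀ f⟩_τ` for every `f ∈ L²(□₀, ·)` — ONE constant for the whole cube family; no geometric hypothesis.
[cite: Balaban1985BackgroundPropagators, Thm 3.1 p.397, Thm 3.11 p.416; Balaban1984PropagatorsII, (2.22) p.226; Balaban1985RegularSpaces, (1.131) p.99] -/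
theorem coercive_near_flat_cubeMember (hη : 0 < η) {a₁ : ℕ → ℝ} (ha : ∀ j, 0 ≤ a₁ j)
    (i : ZdIdx d L) {a : Site d} {Mc ρ : ℕ} (hΩ : i.Ω = cubeFam false L a Mc ρ i.k) (hρ : L ≤ ρ) {m : ℕ} (hm : m ≤ i.k)
    (hηL : ∀ j ∈ Finset.range (m + 1), η * (L : ℝ) ^ j ≤ 1)
    {a₀ : ℝ} (ha₀8 : a₀ ≤ 8) (ha₀ : ∀ j ∈ Finset.range (m + 1), a₀ * ((L : ℝ) ^ j) ^ d ≤ a₁ j * η ^ 2 * ((L : ℝ) ^ j) ^ 2)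
    (hU : ∀ (x : Site d) (κ' : Fin d), U₀ x κ' ∈ unitaryUnits 𝔸)
    (hR : ∀ (x : Site d) (μ : Fin d) (b : 𝔸), fnorm τ (conjR (U₀ x μ) b - b) ≤ θ * η * fnorm τ b)
    {ε : ℕ → ℝ} (hε : ∀ i', 0 ≤ ε i') (hT : ∀ i', i' < m → ∀ z y : Site d, bgT L U₀ i' z y ∈ unitaryUnits 𝔸)
    (hTε : ∀ i', i' < m → ∀ (w : Site d) (b : 𝔸), fnorm τ (conjR (bgT L U₀ i' (blockMap L w) w) b - b) ≤ ε i' * fnorm τ b)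
    {κ : ℝ} (hκ0 : 0 ≤ κ) (hκ : ∀ j ∈ Finset.range (m + 1), a₁ j * ((((L : ℝ) ^ d) ^ j)⁻¹ * (∑ i' ∈ Finset.range j, ε i') ^ 2) ≤ κ)
    (f : suppSub (𝔸 := 𝔸) (cubeMember_Ω0_finite i hΩ).toFinset) :
    (a₀ / 2 - d * θ ^ 2 - κ) * formE τ (cubeMember_Ω0_finite i hΩ).toFinset f f ≤
      formE τ (cubeMember_Ω0_finite i hΩ).toFinset f
        (deltaPrimeADom L U₀ η τ hτp m a₁ (fun j => (cubeLamS_finite L a Mc ρ i.k m j).toFinset) (cubeMember_Ω0_finite i hΩ).toFinset f) :=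
  coercive_of_flat_coercive_near_flat' τ hτp hτt hτs hη hU hR m ha _
    (fun j hj y hy => ((fullBlockGeometry_cubeMember i hΩ hρ hm) j hj y hy).2) hε hT hTε hκ0 hκ
    (fun g => formE_deltaPrimeADom_one_coercive_cubeMember τ hτp hτt hτs hη ha i hΩ hρ hm hηL ha₀8 ha₀ g) f


/-! ## §2  Readings with OPERATOR-NORM closeness (`‖U₀(b) − 1‖ ≤ θ′η`, `‖Ū₀ⁱ(Γ) − 1‖ ≤ ε′_i`) via the norm comparison of the `τ`-size -/

section OperatorNorm

variable [Nontrivial 𝔸]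

omit [FiniteDimensional ℝ 𝔸] in
/-- the `τ`-size of a conjugation defect from the operator norm: with comparison constants `|a|_τ ≤ C_u‖a‖`, `‖a‖ ≤ C_l|a|_τ` (dag-n06-b's
`B9Eq326LocalLettersBumpBoundsZd.exists_fnorm_cmp`) and dag-n05's `‖R(u)Z − Z‖ ≤ 2‖u − 1‖‖Z‖`, `|R(u)b − b|_τ ≤ 2C_uC_l‖u − 1‖·|b|_τ` for unitary `u`.
[cite: Balaban1985Averaging, (122)–(126) p.36; Balaban1985BackgroundPropagators, p.416 («U = e^{iηA} with A small»)] -/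
theorem fnorm_conjR_sub_le_of_cmp {Cu Cl : ℝ} (hCu : ∀ a : 𝔸, fnorm τ a ≤ Cu * ‖a‖) (hCl : ∀ a : 𝔸, ‖a‖ ≤ Cl * fnorm τ a) (hCu0 : 0 ≤ Cu)
    {u : 𝔸ˣ} (hu : u ∈ unitaryUnits 𝔸) (b : 𝔸) : fnorm τ (conjR u b - b) ≤ (2 * Cu * Cl * ‖(u : 𝔸) - 1‖) * fnorm τ b := by
  have h1 := B8Eq143PlaqExpansion.norm_conjR_sub_self_le (B7Prop2Explicit.unitaryUnits_le_U1 hu) b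
  have h2 : 0 ≤ 2 * ‖(u : 𝔸) - 1‖ := by positivity
  calc fnorm τ (conjR u b - b) ≤ Cu * ‖conjR u b - b‖ := hCu _
    _ ≤ Cu * (2 * ‖(u : 𝔸) - 1‖ * ‖b‖) := mul_le_mul_of_nonneg_left h1 hCu0
    _ ≤ Cu * (2 * ‖(u : 𝔸) - 1‖ * (Cl * fnorm τ b)) := mul_le_mul_of_nonneg_left (mul_le_mul_of_nonneg_left (hCl b) h2) hCu0
    _ = (2 * Cu * Cl * ‖(u : 𝔸) - 1‖) * fnorm τ b := by ring

include hτt hτs in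
/-- ★★★ **THE NEAR-FLAT COERCIVITY AT EVERY CUBE MEMBER WITH OPERATOR-NORM HYPOTHESES**: given norm-comparison constants `C_u, C_l` of the `τ`-size (`exists_fnorm_cmp`), a unitary
`U₀` with `‖U₀(b) − 1‖ ≤ θ′η` on all bonds and unitary averaged transporters with `‖Ū₀ⁱ(Γ) − 1‖ ≤ ε′_i` below `m`, weights with `a₀(Lʲ)^d ≤ a_jη²(Lʲ)²` (`a₀ ≤ 8`) and
`a_j(Lᵈ)^{−j}(Σ_{i<j}ε′_i)² ≤ κ′`, `η·Lʲ ≤ 1`: `(a₀∕2 − (2C_uC_l)²(dθ′² + κ′))·⟨f, f⟩_τ ≤ ⟨f, □₀Δ′_a(U₀)□₀ f⟩_τ` for every `f ∈ L²(□₀, ·)` — one constant for the cube family.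
[cite: Balaban1985BackgroundPropagators, Thm 3.1 p.397, Thm 3.11 p.416, (3.86) p.407; Balaban1984PropagatorsII, (2.22) p.226; Balaban1985Averaging, (122)–(126) p.36; Balaban1985RegularSpaces, (1.131) p.99] -/
theorem coercive_near_flat_cubeMember_of_norm {Cu Cl : ℝ} (hCu : ∀ a : 𝔸, fnorm τ a ≤ Cu * ‖a‖) (hCl : ∀ a : 𝔸, ‖a‖ ≤ Cl * fnorm τ a)
    (hCu0 : 0 ≤ Cu) (hCl0 : 0 ≤ Cl) (hη : 0 < η) {a₁ : ℕ → ℝ} (ha : ∀ j, 0 ≤ a₁ j)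
    (i : ZdIdx d L) {a : Site d} {Mc ρ : ℕ} (hΩ : i.Ω = cubeFam false L a Mc ρ i.k) (hρ : L ≤ ρ) {m : ℕ} (hm : m ≤ i.k)
    (hηL : ∀ j ∈ Finset.range (m + 1), η * (L : ℝ) ^ j ≤ 1)
    {a₀ : ℝ} (ha₀8 : a₀ ≤ 8) (ha₀ : ∀ j ∈ Finset.range (m + 1), a₀ * ((L : ℝ) ^ j) ^ d ≤ a₁ j * η ^ 2 * ((L : ℝ) ^ j) ^ 2)
    (hU : ∀ (x : Site d) (κ' : Fin d), U₀ x κ' ∈ unitaryUnits 𝔸)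
    {θ' : ℝ} (hR : ∀ (x : Site d) (μ : Fin d), ‖((U₀ x μ : 𝔸ˣ) : 𝔸) - 1‖ ≤ θ' * η)
    {ε' : ℕ → ℝ} (hε' : ∀ i', 0 ≤ ε' i') (hT : ∀ i', i' < m → ∀ z y : Site d, bgT L U₀ i' z y ∈ unitaryUnits 𝔸)
    (hTε : ∀ i', i' < m → ∀ (w : Site d), ‖((bgT L U₀ i' (blockMap L w) w : 𝔸ˣ) : 𝔸) - 1‖ ≤ ε' i')
    {κ' : ℝ} (hκ0 : 0 ≤ κ') (hκ : ∀ j ∈ Finset.range (m + 1), a₁ j * ((((L : ℝ) ^ d) ^ j)⁻¹ * (∑ i' ∈ Finset.range j, ε' i') ^ 2) ≤ κ')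
    (f : suppSub (𝔸 := 𝔸) (cubeMember_Ω0_finite i hΩ).toFinset) :
    (a₀ / 2 - (2 * Cu * Cl) ^ 2 * (d * θ' ^ 2 + κ')) * formE τ (cubeMember_Ω0_finite i hΩ).toFinset f f ≤
      formE τ (cubeMember_Ω0_finite i hΩ).toFinset f
        (deltaPrimeADom L U₀ η τ hτp m a₁ (fun j => (cubeLamS_finite L a Mc ρ i.k m j).toFinset) (cubeMember_Ω0_finite i hΩ).toFinset f) := by
  set C : ℝ := 2 * Cu * Cl with hC
  have hC0 : 0 ≤ C := by positivity
  -- the τ-size hypotheses with `θ := Cθ′`, `ε := Cε′`, `κ := C²κ′`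
  have hRτ : ∀ (x : Site d) (μ : Fin d) (b : 𝔸), fnorm τ (conjR (U₀ x μ) b - b) ≤ (C * θ') * η * fnorm τ b := by
    intro x μ b
    refine (fnorm_conjR_sub_le_of_cmp τ hCu hCl hCu0 (hU x μ) b).trans ?_
    rw [← hC]
    have hb := B9Eq342CombesThomasFormZd.fnorm_nonneg τ b
    calc C * ‖((U₀ x μ : 𝔸ˣ) : 𝔸) - 1‖ * fnorm τ b ≤ C * (θ' * η) * fnorm τ b :=
          mul_le_mul_of_nonneg_right (mul_le_mul_of_nonneg_left (hR x μ) hC0) hb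
      _ = (C * θ') * η * fnorm τ b := by ring
  have hTτ : ∀ i', i' < m → ∀ (w : Site d) (b : 𝔸), fnorm τ (conjR (bgT L U₀ i' (blockMap L w) w) b - b) ≤ (C * ε' i') * fnorm τ b := by
    intro i' hi' w b
    refine (fnorm_conjR_sub_le_of_cmp τ hCu hCl hCu0 (hT i' hi' _ _) b).trans ?_
    rw [← hC]
    exact mul_le_mul_of_nonneg_right (mul_le_mul_of_nonneg_left (hTε i' hi' w) hC0) (B9Eq342CombesThomasFormZd.fnorm_nonneg τ b)
  have hκτ : ∀ j ∈ Finset.range (m + 1), a₁ j * ((((L : ℝ) ^ d) ^ j)⁻¹ * (∑ i' ∈ Finset.range j, C * ε' i') ^ 2) ≤ C ^ 2 * κ' := by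
    intro j hj
    rw [← Finset.mul_sum, mul_pow]
    calc a₁ j * ((((L : ℝ) ^ d) ^ j)⁻¹ * (C ^ 2 * (∑ i' ∈ Finset.range j, ε' i') ^ 2))
        = C ^ 2 * (a₁ j * ((((L : ℝ) ^ d) ^ j)⁻¹ * (∑ i' ∈ Finset.range j, ε' i') ^ 2)) := by ring
      _ ≤ C ^ 2 * κ' := mul_le_mul_of_nonneg_left (hκ j hj) (sq_nonneg C)
  have h := coercive_near_flat_cubeMember τ hτp hτt hτs hη ha i hΩ hρ hm hηL ha₀8 ha₀ hU hRτ (fun i' => mul_nonneg hC0 (hε' i')) hT hTτ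
    (by positivity) hκτ f
  have hconst : a₀ / 2 - (2 * Cu * Cl) ^ 2 * (d * θ' ^ 2 + κ') = a₀ / 2 - d * (C * θ') ^ 2 - C ^ 2 * κ' := by rw [hC]; ring
  rw [hconst]
  exact h

end OperatorNorm


/-! ## §3  Consequence: the member-uniform `L²_τ` bound of `G′(U₀) = (□₀Δ′_a(U₀)□₀)⁻¹` at near-flat backgrounds -/

section GreenPrime

include hτt hτs in
/-- ★★ **`‖G′(U₀)f‖²_τ ≤ γ⁻²·‖f‖²_τ` WITH THE MEMBER-UNIFORM `γ = a₀∕2 − dθ² − κ > 0`** at every cube member and every near-flat unitary background as in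
`coercive_near_flat_cubeMember` (g4's `B9Thm311InverseL2BoundsZd.formE_GpZd_self_le_of_coercive` fed with the uniform constant) — [Balaban1985BackgroundPropagators] Thm 3.1's
`L²` content for `G′` with a constant free of `η`, `m`, `M` and the member. [cite: Balaban1985BackgroundPropagators, Thm 3.1 p.397, (3.42) p.397, (3.24) p.394, Thm 3.11 p.416; Balaban1984PropagatorsII, (2.22) p.226] -/
theorem formE_GpZd_self_le_near_flat_cubeMember (hd : 0 < d) (hη : 0 < η) {a₁ : ℕ → ℝ} (ha : ∀ j, 0 ≤ a₁ j)
    (i : ZdIdx d L) {a : Site d} {Mc ρ : ℕ} (hΩ : i.Ω = cubeFam false L a Mc ρ i.k) (hρ : L ≤ ρ) {m : ℕ} (hm : m ≤ i.k)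
    (hηL : ∀ j ∈ Finset.range (m + 1), η * (L : ℝ) ^ j ≤ 1)
    {a₀ : ℝ} (ha₀8 : a₀ ≤ 8) (ha₀ : ∀ j ∈ Finset.range (m + 1), a₀ * ((L : ℝ) ^ j) ^ d ≤ a₁ j * η ^ 2 * ((L : ℝ) ^ j) ^ 2)
    (hU : ∀ (x : Site d) (κ' : Fin d), U₀ x κ' ∈ unitaryUnits 𝔸)
    (hR : ∀ (x : Site d) (μ : Fin d) (b : 𝔸), fnorm τ (conjR (U₀ x μ) b - b) ≤ θ * η * fnorm τ b)
    {ε : ℕ → ℝ} (hε : ∀ i', 0 ≤ ε i') (hT : ∀ i', i' < m → ∀ z y : Site d, bgT L U₀ i' z y ∈ unitaryUnits 𝔸)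
    (hTε : ∀ i', i' < m → ∀ (w : Site d) (b : 𝔸), fnorm τ (conjR (bgT L U₀ i' (blockMap L w) w) b - b) ≤ ε i' * fnorm τ b)
    {κ : ℝ} (hκ0 : 0 ≤ κ) (hκ : ∀ j ∈ Finset.range (m + 1), a₁ j * ((((L : ℝ) ^ d) ^ j)⁻¹ * (∑ i' ∈ Finset.range j, ε i') ^ 2) ≤ κ)
    (hγ : 0 < a₀ / 2 - d * θ ^ 2 - κ)
    (f : suppSub (𝔸 := 𝔸) (cubeMember_Ω0_finite i hΩ).toFinset) :
    formE τ (cubeMember_Ω0_finite i hΩ).toFinset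
        (GpZd L U₀ η τ hτp m a₁ (fun j => (cubeLamS_finite L a Mc ρ i.k m j).toFinset) (cubeMember_Ω0_finite i hΩ).toFinset hd hη.ne' hτt hτs hU ha f)
        (GpZd L U₀ η τ hτp m a₁ (fun j => (cubeLamS_finite L a Mc ρ i.k m j).toFinset) (cubeMember_Ω0_finite i hΩ).toFinset hd hη.ne' hτt hτs hU ha f) ≤
      (a₀ / 2 - d * θ ^ 2 - κ)⁻¹ ^ 2 * formE τ (cubeMember_Ω0_finite i hΩ).toFinset f f :=
  formE_GpZd_self_le_of_coercive τ hτp hτt hτs hd hη.ne' m ha _ _ hU hγ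
    (fun g => coercive_near_flat_cubeMember τ hτp hτt hτs hη ha i hΩ hρ hm hηL ha₀8 ha₀ hU hR hε hT hTε hκ0 hκ g) f

end GreenPrime

end Literature.MathematicalPhysics.QuantumFieldTheory.Balaban1983to89.B9Thm31NearFlatCoerciveCubeZd

end
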